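import Mathlib.Data.Real.Basic
import Mathlib.Tactic
import HarnessLib

/-!
# Sign geometry of the helical (Waleffe) interaction pattern of one triad — design constraints
# for Euler-embedded gates

HONEST FRAMING (cell `pub-fluidc`, blueprint seat bp2, gen 48; verbatim): *low prior, high
value-of-information experiment on Tao's machine paradigm; NOT a claim that NS blows up.*
MODEL-side elementary real algebra; nothing here is a statement about the Navier–Stokes or Euler
equations.  These are OUR lemmas — the typed form of the "structural fact" of bp2's
COUPLING-MODEL v0.1.13 §3(a) and of the "no clean upward gate" corollary of §2f, used by the
pre-registered Galerkin experiments GFT-4L / GFT-4V and by GADGETS' clean-gate audit; they are not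
literature statements.

SETTING.  In the helical decomposition of the Fourier–Galerkin truncation of the incompressible
Euler nonlinearity, one helical sub-triad with wavenumber moduli `k p q > 0` and helicity signs
`sk sp sq ∈ {±1}` exchanges energy between its three legs at instantaneous rates
`T = (T_k, T_p, T_q) = R(t) · C` with ONE common real factor `R(t)` (amplitudes, triad phase and
the geometric factor `[h × h · h]`) and the fixed pattern, up to a common non-zero factor,

  `C = (C_k, C_p, C_q) = (sq·q − sp·p, sk·k − sq·q, sp·p − sk·k)`

[cite: Waleffe1992, §II helical-mode triad equations: leg coefficient
`(s₁k₁ − s₂k₂)·[h×h·h]`, as reproduced in arXiv:2105.09425 §3.2 (p. 8) with the class I–IV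
discussion §3.2.2 (p. 10)].

WHAT IS TYPED (all over `ℝ`; a helicity sign is a real `s` with `s = 1 ∨ s = -1`):
* `pattern_energy`   : `C_k + C_p + C_q = 0` (energy conservation inside the sub-triad);
* `pattern_helicity` : `sk·k·C_k + sp·p·C_p + sq·q·C_q = 0` (helicity conservation);
* `conserving_coeffs_parallel` : ANY real triple `(x, y, z)` with `x + y + z = 0` and
  `sk·k·x + sp·p·y + sq·q·z = 0` is parallel to `C` (all three 2×2 minors vanish), and
  `conserving_coeffs_multiple` : if `C_k ≠ 0` it is the multiple `(x / C_k) • C` — a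
  within-triad distortion of the coefficients other than a common rescaling breaks energy or
  helicity conservation (memo §3(a): GFT-3's per-triple gains exhaust the doubly-conserving
  family);
* `apex_silent_iff`  : for `p, q > 0`, `C_k = 0 ↔ (sp = sq ∧ p = q)` — the apex of an
  isosceles sub-triad is fed iff its two equal legs are HETEROCHIRAL (memo §2b E3: the homochiral
  keystone hand-over `d·d → a` of the k6h4n16 wiring is exactly silent);
* `no_clean_upward_gate` : if `k` is STRICTLY the largest modulus then `C_p · C_q < 0` whatever
  the three signs — the two smaller legs' coefficients have opposite signs, so the largest leg is
  never the odd-sign leg (Waleffe's "the largest wavenumber is never the unstable mode", read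
  from the target side);
* `locked_upward_transfer_has_cogainer` : hence a locked transfer `T = u·C` feeding the largest
  leg (`u·C_k > 0`) drains one smaller leg and strictly CO-FEEDS the other;
* `source_drains_more_than_target_gains` : with a co-gainer `p` (`u·C_p > 0`) the source `q`
  gives up strictly more than the target receives: `u·C_k < −(u·C_q)`.

HONEST LIMITS: (i) sign/magnitude facts about the fixed pattern `C` only — nothing about the time
factor `R(t)`, phases, or which transfers a flow realises; (ii) "no clean upward gate" is a
statement about ONE sub-triad at ONE instant; compound or time-dependent gates are not excluded;
(iii) nothing about Navier–Stokes.
-/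

namespace Summit.NavierStokesRegularity.FluidComputer.TriadSignGeometry

set_option linter.unusedVariables false in
/-- The helical interaction pattern of a sub-triad `(sk,k) (sp,p) (sq,q)`: the `k`-leg
component (all six arguments are kept so that the three components share one signature). -/
def Ck (sk sp sq k p q : ℝ) : ℝ := sq * q - sp * p
set_option linter.unusedVariables false in
/-- The `p`-leg component of the pattern. -/
def Cp (sk sp sq k p q : ℝ) : ℝ := sk * k - sq * q
set_option linter.unusedVariables false in
/-- The `q`-leg component of the pattern. -/
def Cq (sk sp sq k p q : ℝ) : ℝ := sp * p - sk * k

section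
variable (sk sp sq k p q : ℝ)

/-- Energy conservation inside the sub-triad: the pattern sums to zero. -/
theorem pattern_energy : Ck sk sp sq k p q + Cp sk sp sq k p q + Cq sk sp sq k p q = 0 := by
  unfold Ck Cp Cq; ring

/-- Helicity conservation inside the sub-triad: the helicity-weighted pattern sums to zero. -/
theorem pattern_helicity :
    sk * k * Ck sk sp sq k p q + sp * p * Cp sk sp sq k p q + sq * q * Cq sk sp sq k p q = 0 := by
  unfold Ck Cp Cq; ring

/-- **The doubly-conserving coefficient family is one-dimensional.**  Any real coefficient triple
`(x, y, z)` on the same trilinear form that conserves energy (`x + y + z = 0`) and helicity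
(`sk·k·x + sp·p·y + sq·q·z = 0`) is parallel to the pattern: every 2×2 minor of
`((x,y,z), (Ck,Cp,Cq))` vanishes.  No non-degeneracy hypothesis is needed for the minors. -/
theorem conserving_coeffs_parallel (x y z : ℝ) (hE : x + y + z = 0)
    (hH : sk * k * x + sp * p * y + sq * q * z = 0) :
    Cp sk sp sq k p q * x - Ck sk sp sq k p q * y = 0 ∧
    Ck sk sp sq k p q * z - Cq sk sp sq k p q * x = 0 ∧
    Cp sk sp sq k p q * z - Cq sk sp sq k p q * y = 0 := by
  unfold Ck Cp Cq
  refine ⟨?_, ?_, ?_⟩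
  · linear_combination hH - sq * q * hE
  · linear_combination hH - sp * p * hE
  · linear_combination -(hH) + sk * k * hE

/-- If the pattern's `k`-component is non-zero, a doubly-conserving triple IS the real multiple
`(x / Ck) • C` of the pattern. -/
theorem conserving_coeffs_multiple (x y z : ℝ) (hE : x + y + z = 0)
    (hH : sk * k * x + sp * p * y + sq * q * z = 0) (hk : Ck sk sp sq k p q ≠ 0) :
    ∃ μ : ℝ, x = μ * Ck sk sp sq k p q ∧ y = μ * Cp sk sp sq k p q ∧
      z = μ * Cq sk sp sq k p q := by
  obtain ⟨h1, h2, _⟩ := conserving_coeffs_parallel sk sp sq k p q x y z hE hH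
  refine ⟨x / Ck sk sp sq k p q, ?_, ?_, ?_⟩
  · field_simp
  · field_simp; linarith
  · field_simp; linarith
end

/-- **Isosceles silence.**  With positive moduli `p, q` and unit signs, the `k`-leg (apex)
coefficient vanishes iff the two other legs have equal modulus AND equal helicity sign: a
homochiral isosceles pair cannot feed its apex at any phase, a heterochiral one can. -/
theorem apex_silent_iff (sk sp sq k p q : ℝ) (hp : 0 < p) (hq : 0 < q)
    (hsp : sp = 1 ∨ sp = -1) (hsq : sq = 1 ∨ sq = -1) :
    Ck sk sp sq k p q = 0 ↔ (sp = sq ∧ p = q) := by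
  unfold Ck
  constructor
  · intro h
    rcases hsp with rfl | rfl <;> rcases hsq with rfl | rfl
    · exact ⟨rfl, by linarith⟩
    · exfalso; linarith
    · exfalso; linarith
    · exact ⟨rfl, by linarith⟩
  · rintro ⟨rfl, rfl⟩; ring

/-- **No clean upward gate.**  If `k` is strictly the largest modulus of the sub-triad, the
coefficients of the two smaller legs have strictly opposite signs, whatever the three helicity
signs.  Hence the largest leg is never the odd-sign leg. -/
theorem no_clean_upward_gate (sk sp sq k p q : ℝ) (hp : 0 < p) (hq : 0 < q) (hpk : p < k)
    (hqk : q < k) (hsk : sk = 1 ∨ sk = -1) (hsp : sp = 1 ∨ sp = -1) (hsq : sq = 1 ∨ sq = -1) :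
    Cp sk sp sq k p q * Cq sk sp sq k p q < 0 := by
  unfold Cp Cq
  rcases hsk with rfl | rfl <;> rcases hsp with rfl | rfl <;> rcases hsq with rfl | rfl <;>
    nlinarith

/-- The same fact for a locked transfer `T = u·C` that feeds the largest leg (`u·C_k > 0`): the
two smaller legs' rates `u·C_p`, `u·C_q` have opposite strict signs — exactly one of them is a
CO-GAINER. -/
theorem locked_upward_transfer_has_cogainer (sk sp sq k p q u : ℝ) (hp : 0 < p) (hq : 0 < q)
    (hpk : p < k) (hqk : q < k) (hsk : sk = 1 ∨ sk = -1) (hsp : sp = 1 ∨ sp = -1)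
    (hsq : sq = 1 ∨ sq = -1) (hu : 0 < u * Ck sk sp sq k p q) :
    (0 < u * Cp sk sp sq k p q ∧ u * Cq sk sp sq k p q < 0) ∨
    (u * Cp sk sp sq k p q < 0 ∧ 0 < u * Cq sk sp sq k p q) := by
  have hprod := no_clean_upward_gate sk sp sq k p q hp hq hpk hqk hsk hsp hsq
  have hu0 : u ≠ 0 := by rintro rfl; simp at hu
  have hu2 : 0 < u * u := mul_self_pos.mpr hu0
  have : (u * Cp sk sp sq k p q) * (u * Cq sk sp sq k p q) < 0 := by nlinarith
  rcases lt_or_gt_of_ne (show u * Cp sk sp sq k p q ≠ 0 from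
      fun h => by rw [h] at this; simp at this) with h | h
  · right; exact ⟨h, by nlinarith⟩
  · left; exact ⟨h, by nlinarith⟩

/-- **Energy bookkeeping of the co-gainer.**  For a locked transfer `T = u·C` with a co-gaining
leg `p` (`u·C_p > 0`), energy conservation gives `u·C_k = (−(u·C_q)) − u·C_p`, hence
`−(u·C_q) > u·C_k`: the source leg `q` gives up strictly more than the target `k` receives (the
difference is the co-gainer's share). -/
theorem source_drains_more_than_target_gains (sk sp sq k p q u : ℝ)
    (hcog : 0 < u * Cp sk sp sq k p q) :
    u * Ck sk sp sq k p q < -(u * Cq sk sp sq k p q) := by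
  have h := pattern_energy sk sp sq k p q
  have h3 : u * Ck sk sp sq k p q + u * Cp sk sp sq k p q + u * Cq sk sp sq k p q = 0 := by
    linear_combination u * h
  linarith

end Summit.NavierStokesRegularity.FluidComputer.TriadSignGeometry
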